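import Mathlib
import Summits.ValiantsHypothesis.ValiantsHypothesis.Theorems.BinomialElusiveBinomialCandidateInfinityStepTwoImproper
import Summits.ValiantsHypothesis.ValiantsHypothesis.Theorems.BinomialElusiveBinomialCandidatePolarStepTwo

/-!
# Crux `BinomialElusive.BinomialCandidate` (stmt-ValiantsHypothesis-7392), line `registered`,
# skeleton v7 — stub `stub_infinityStepTwoImproperMinors` (∞-2'm): the second peeling step at the
# place over `x = ∞`, improper branch, with the integral remainder recorded through the minors

The registered stub `stub_infinityStepTwoImproperMinors` of the crux
`Summit.ValiantsHypothesis.ValiantsHypothesis.Theses.BinomialElusive.BinomialCandidate`.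
Data (as in the sibling stub `stub_infinityStepTwoImproper`): a quadratic `Γ : ℂ^s → ℂ^m`
(`totalDegree (Γ i) ≤ 2`), `m ≥ 1`, `N ≥ 1`, `a i < b i`, `b` injective, a formal Laurent solution
`p` of `Γ_i(p) = t^{-N a_i} + t^{-N b_i}` with least order `μ < 0`, pole direction
`z = (p_j.coeff μ)_j ≠ 0`, and `B_i(z) = 0` for ALL `i` (`B_i = homogeneousComponent 2 (Γ i)`).
Claim (dichotomy): EITHER there are a second direction `z' ∉ ℂ z` and an index `i₁` with
`Σ_j z'_j ∂_jB_i(z) = 0` for all `i ≠ i₁`, OR all the `2 × 2` minors `z_k p_j - z_j p_k` are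
integral (no coefficients at negative exponents).

Proof.  Take the chart of the pole `PolarStepTwo.exists_chart`: `p j = Λ q j` with `Λ` normalised
(no coefficients below `μ`, coefficient `1` at `μ`), every `q j` the jet `z j + v j t^o` up to the
order `0 < o ≤ -μ`, `v j₀ = 0` for a coordinate with `z j₀ ≠ 0`, and `v ≠ 0` if `o < -μ`.

* `o < -μ` (the remainder has a pole): verbatim the first branch of the tree proof of
  `stub_infinityStepTwoImproper` — the coefficient of `Γ_i(p)` at `2μ + o` is `Σ_j v_j ∂_jB_i(z)`
  (`InfinityStepTwo.coeff_aeval_of_jet`), nonzero only if `2μ + o = -N b_i`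
  (`InfinityCommonZero.le_and_eq_zero_or_eq`), which by injectivity of `b` happens for at most one
  index `i₁`; and `v ≠ 0`, `v j₀ = 0 ≠ z j₀` give `v ∉ ℂ z`.  First disjunct with `z' = v`.
* `o = -μ` (the remainder is integral): the minors are `z_k p_j - z_j p_k = Λ (z_k q_j - z_j q_k)`,
  and `z_k q_j - z_j q_k` has no coefficients below `o` by the jet formula (the constant terms
  `z_k z_j - z_j z_k` cancel), so the product has none below `μ + o = 0`
  (`PolarPeeling.coeff_mul_eq_zero_of_lt`).  Second disjunct.

Mathlib only, plus the tree files imported above (`PolarStepTwo.exists_chart`,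
`InfinityStepTwo.coeff_aeval_of_jet`, `InfinityCommonZero.le_and_eq_zero_or_eq`,
`PolarPeeling.coeff_mul_eq_zero_of_lt`).
-/

-- layout Summits/ValiantsHypothesis/ValiantsHypothesis forces the duplicated namespace component
set_option linter.dupNamespace false

namespace Summit.ValiantsHypothesis.ValiantsHypothesis.Theorems.BinomialCandidateStubs

open scoped BigOperators

namespace InfinityStepTwoImproperMinors

/-- **The minors in the chart have no coefficients below `o`.**  If every `q j` is the jet
`z j + v j t^o` up to order `o`, then `z k • q j - z j • q k` has no coefficients below `o`
(below `o` only the constant terms `z k z j - z j z k = 0` occur). -/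
theorem coeff_minor_eq_zero {s : ℕ} {o : ℤ} (q : Fin s → LaurentSeries ℂ) (z v : Fin s → ℂ)
    (hq : ∀ j, ∀ g ≤ o, (q j).coeff g = (if g = 0 then z j else 0) + if g = o then v j else 0)
    (j k : Fin s) : ∀ g < o, (z k • q j - z j • q k).coeff g = 0 := by
  intro g hg
  rw [HahnSeries.coeff_sub, HahnSeries.coeff_smul, HahnSeries.coeff_smul, smul_eq_mul, smul_eq_mul,
    hq j g hg.le, hq k g hg.le, if_neg hg.ne, if_neg hg.ne, add_zero, add_zero]
  split_ifs <;> ring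

/-- **The minors factor through the chart**: `z k • (Λ q j) - z j • (Λ q k) = Λ (z k • q j - z j • q k)`.
-/
theorem minor_eq_mul {s : ℕ} (Λ : LaurentSeries ℂ) (q : Fin s → LaurentSeries ℂ) (z : Fin s → ℂ)
    (j k : Fin s) : z k • (Λ * q j) - z j • (Λ * q k) = Λ * (z k • q j - z j • q k) := by
  simp only [← HahnSeries.C_mul_eq_smul]
  ring

end InfinityStepTwoImproperMinors

open InfinityStepTwoImproperMinors in
/-- **Stub `stub_infinityStepTwoImproperMinors`** (crux stmt-ValiantsHypothesis-7392, line
`registered`, skeleton v7, ∞-2'm): the second peeling step at the place over `x = ∞` in the improper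
branch, with the integral remainder recorded through the minors.  Given `m ≥ 1` and a formal
Laurent solution `p` of `Γ_i(p) = t^{-N a_i} + t^{-N b_i}` (`Γ` quadratic, `N ≥ 1`, `a_i < b_i`,
`b` injective) with least order `μ < 0`, pole direction `z = (p_j.coeff μ)_j ≠ 0` and `B_i(z) = 0`
for all `i` (`B_i = homogeneousComponent 2 (Γ i)`): either there are a second direction `z' ∉ ℂ z`
and an index `i₁` with `Σ_j z'_j ∂_jB_i(z) = 0` for all `i ≠ i₁`, or every minor
`z_k p_j - z_j p_k` has no coefficients at negative exponents. -/
theorem stub_infinityStepTwoImproperMinors :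
    ∀ (m s : ℕ) (a b : Fin m → ℕ) (Γ : Fin m → MvPolynomial (Fin s) ℂ) (N : ℕ) (p : Fin s → LaurentSeries ℂ)
      (μ : ℤ), 0 < m → (∀ i, (Γ i).totalDegree ≤ 2) → 0 < N → (∀ i, a i < b i) → Function.Injective b →
      (∀ i, MvPolynomial.aeval p (Γ i) =
        HahnSeries.single (-((N * a i : ℕ) : ℤ)) (1 : ℂ) + HahnSeries.single (-((N * b i : ℕ) : ℤ)) (1 : ℂ)) →
      μ < 0 → (∀ j, ∀ g < μ, (p j).coeff g = 0) → (fun j => (p j).coeff μ) ≠ 0 →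
      (∀ i, MvPolynomial.eval (fun j => (p j).coeff μ) (MvPolynomial.homogeneousComponent 2 (Γ i)) = 0) →
      (∃ z' : Fin s → ℂ, (∀ c : ℂ, z' ≠ c • (fun j => (p j).coeff μ)) ∧ ∃ i₁ : Fin m, ∀ i, i ≠ i₁ →
          ∑ j, z' j * MvPolynomial.eval (fun l => (p l).coeff μ)
            (MvPolynomial.pderiv j (MvPolynomial.homogeneousComponent 2 (Γ i))) = 0) ∨
      (∀ j k, ∀ g < 0, ((p k).coeff μ • p j - (p j).coeff μ • p k).coeff g = 0) := by
  intro m s a b Γ N p μ hm hΓ hN hab hb hsol hμ hp hz hBz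
  classical
  -- the pole direction `z` and a coordinate `j₀` with `z j₀ ≠ 0`
  set z : Fin s → ℂ := fun j => (p j).coeff μ
  obtain ⟨j₀, hj₀⟩ : ∃ j₀, z j₀ ≠ 0 := Function.ne_iff.mp hz
  -- the chart of the pole: `p j = Λ q j`, `q j` the jet `z j + v j t^o`, `0 < o ≤ -μ`, `v j₀ = 0`
  obtain ⟨Λ, q, o, v, hΛvan, hΛμ, hpq, ho, hoμ, hjq, hvj₀, hv0⟩ :=
    PolarStepTwo.exists_chart p hμ hp z (fun _ => rfl) hj₀
  rcases hoμ.lt_or_eq with hlt | heq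
  · -- `o < -μ` (the remainder has a pole): the direction `v ∉ ℂ z`, first disjunct
    left
    -- the exponents of the target: `-N b_i < -N a_i`
    have huv : ∀ i, -((N * b i : ℕ) : ℤ) < -((N * a i : ℕ) : ℤ) := fun i =>
      neg_lt_neg (by exact_mod_cast Nat.mul_lt_mul_of_pos_left (hab i) hN)
    -- "all but at most one index": an equation `ν = -N b_i` singles out at most one `i`
    have hsel : ∀ (P : Fin m → Prop) (ν : ℤ), (∀ i, P i ∨ ν = -((N * b i : ℕ) : ℤ)) →
        ∃ i₁ : Fin m, ∀ i, i ≠ i₁ → P i := by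
      intro P ν h
      by_cases hex : ∃ i₁ : Fin m, ν = -((N * b i₁ : ℕ) : ℤ)
      · obtain ⟨i₁, hi₁⟩ := hex
        refine ⟨i₁, fun i hi => (h i).resolve_right fun h' =>
          hi (hb (Nat.eq_of_mul_eq_mul_left hN ?_))⟩
        have h'' : ((N * b i : ℕ) : ℤ) = ((N * b i₁ : ℕ) : ℤ) := neg_inj.mp (h'.symm.trans hi₁)
        exact_mod_cast h''
      · exact ⟨⟨0, hm⟩, fun i _ => (h i).resolve_right fun h' => hex ⟨i, h'⟩⟩
    -- the outputs in the chart and their lowest orders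
    have hsol' : ∀ i, MvPolynomial.aeval (fun j => Λ * q j) (Γ i) =
        HahnSeries.single (-((N * a i : ℕ) : ℤ)) (1 : ℂ) +
          HahnSeries.single (-((N * b i : ℕ) : ℤ)) (1 : ℂ) := by
      intro i
      have h := hsol i
      rw [hpq] at h
      exact h
    have key := fun i => InfinityStepTwo.coeff_aeval_of_jet ho hoμ Λ hΛvan hΛμ q z v hjq (Γ i)
      (hΓ i) (hBz i)
    have hcmp : ∀ i,
        (∑ j, v j * MvPolynomial.eval z
          (MvPolynomial.pderiv j (MvPolynomial.homogeneousComponent 2 (Γ i))) = 0 ∨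
          μ + μ + o = -((N * b i : ℕ) : ℤ)) := fun i =>
      (InfinityCommonZero.le_and_eq_zero_or_eq (huv i) (hsol' i) (key i).1 ((key i).2 hlt)).2
    -- `v ∉ ℂ z`: `v j₀ = 0 ≠ z j₀` and `v ≠ 0`
    have hv : ∀ c : ℂ, v ≠ c • z := by
      intro c hc
      have hc₀ := congr_fun hc j₀
      simp only [Pi.smul_apply, smul_eq_mul] at hc₀
      rw [hvj₀] at hc₀
      rcases mul_eq_zero.mp hc₀.symm with h | h
      · refine hv0 hlt ?_
        rw [hc, h, zero_smul]
      · exact hj₀ h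
    obtain ⟨i₁, hi₁⟩ := hsel _ _ hcmp
    exact ⟨v, hv, i₁, hi₁⟩
  · -- `o = -μ` (the remainder is integral): every minor `z_k p_j - z_j p_k = Λ (z_k q_j - z_j q_k)`
    -- has no coefficients below `μ + o = 0`
    right
    intro j k g hg
    have e : ∀ j, p j = Λ * q j := fun j => congr_fun hpq j
    show (z k • p j - z j • p k).coeff g = 0
    rw [e j, e k, minor_eq_mul Λ q z j k]
    exact PolarPeeling.coeff_mul_eq_zero_of_lt hΛvan (coeff_minor_eq_zero q z v hjq j k) g
      (by omega)

end Summit.ValiantsHypothesis.ValiantsHypothesis.Theorems.BinomialCandidateStubs
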